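import Summits.ABC.ABC.Theses.RibetTakahashiSplit

/-!
# Line `unramified-window-census` for crux `ManyPrimeValuationProduct` (stmt-ABC-1561) — rev 2 (lead)

Crux (route `RibetTakahashiSplit`, r2): for `E/ℚ` semistable away from `2` with `≥ 4` odd multiplicative
primes, `T(E) := ∏_{p ∥ N} ord_p Δ_min ≤ C_ε N^ε`.

REV 2 (lead prover-line-stmt-ABC-1561-0, 2026-08-16, after wave 1). The planner's skeleton (rev 1) reduced
the crux to four regime statements indexed by the SIZE of `v_p = ord_p Δ_min`:
tiny `v_p ≤ (log N)^ε` (free, `stub_omegaLogLog`) · mid (COUNT, `stub_midCensus`) · giant = bounded COUNT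
(`stub_giantCount`, NOT implied by the crux) × one-prime SIZE (`stub_singlePrime`). Wave 1: `stub_omegaLogLog`
LANDED (p76120, `Summit.ABC.ABC.Theorems.stub_omegaLogLog`, C₀ = 4); `stub_giantCount` came back
`stub-blocked: SzpiroConjecture` (it is a strengthening the crux does not imply), `stub_singlePrime`
`stub-blocked:` the crux itself. RESHAPE: the giant regime is now ONE stub, the giant MASS
`Σ_{p ∥ N, v_p > log N} log v_p ≤ ε log N + C` (`stub_giantMass`), which IS implied by the crux (sum of a
sub-family of the non-negative terms of `log T`) and implies `stub_singlePrime`; `stub_giantCount` is dropped.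
Consequence, kernel-checked in the two directions (`of_parts` here; `midCensus_of_manyPrime`,
`giantMass_of_manyPrime` in the evidence file `Converses.lean`): given the landed `stub_omegaLogLog`,
  crux ⟺ stub_midCensus ∧ stub_giantMass,
so the line is now an EQUIVALENT regime split with two open stubs, both necessary — nothing false can be
chased, nothing is lost. It still supplies no lever (triage r1 ×3; accepted): both open stubs are Conj-1.14
content (Pasten Cor 16.2 gives each with `11/2 + ε` in place of `ε`: `midCensus_rung_of_cor_16_2`).

* tiny   `v_p ≤ (log N)^ε`       — free: `ω(N)·ε·log log N ≤ C₀ ε log N` (`stub_omegaLogLog`, LANDED);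
* mid    `(log N)^ε < v_p ≤ log N` — COUNT bound `#{p} · log log N ≤ ε log N + C` (`stub_midCensus`, open);
* giant  `v_p > log N`            — MASS bound `Σ log v_p ≤ ε log N + C` (`stub_giantMass`, open).

`ManyPrimeValuationProduct_of` concludes the route decl by name from the three stubs.
Honours Disproof v4 (known through its evidence notes; body not mounted on this hub): §3/§4 (ε kept in both
open stubs; no ε-free / uniform-C / polylog claim), §5 (each stub ⟸ quasi-polynomial Szpiro of fixed degree),
§6 (`factorization_le_of_manyPrime` = crux ⇒ single-prime bound, now a corollary of `stub_giantMass`).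
-/

-- `Summit.<Summit>.<Problem>`: for the single-conjunct summit `ABC` the duplicate `ABC.ABC` is mandated.
set_option linter.dupNamespace false

namespace Summit.ABC.ABC.Cruxes.ManyPrimeValuationProduct.UnramifiedWindowCensus

open scoped BigOperators
open Finset

/-! ## Registered stubs -/

/-- **stub 1 — maximal order of `ω`** (`ω(n)·log log n ≤ C₀ log n`). LANDED in wave 1:
`Summit.ABC.ABC.Theorems.stub_omegaLogLog` (p76120, C₀ = 4, split of the prime factors at `√log n`,
file `Summits/ABC/ABC/Theorems/RibetTakahashiSplitManyPrimeValuationProductOmegaLogLog.lean`). The `sorry`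
below is replaced by `import Summits.ABC.ABC.Theorems.RibetTakahashiSplitManyPrimeValuationProductOmegaLogLog`
+ `_root_.Summit.ABC.ABC.Theorems.stub_omegaLogLog` (file `work/ManyPrimeValuationProduct.rev2-import.lean`,
identical otherwise) as soon as that module is built on the farm. -/
theorem stub_omegaLogLog :
    ∃ C₀ : ℝ, ∀ n : ℕ, (n.primeFactors.card : ℝ) * Real.log (Real.log n) ≤ C₀ * Real.log n := by
  sorry

/-- **stub 2 — mid-exponent census (HARDEST; the counting heart of the crux; held by the lead).**
For every `ε > 0` there is `C` such that on the class (semistable away from `2`, `≥ 4` odd multiplicative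
primes) the number `m` of multiplicative primes `p` with `log (ord_p Δ_min) > ε log log N` satisfies
`m · log log N ≤ ε log N + C`.  Implied by the crux (apply it at `ε²`; certificate `midCensus_of_manyPrime`),
hence a genuinely weaker truth claim; in print only with `(11/2+1)/ε` in place of `ε` (Pasten Cor 16.2;
certificate `midCensus_rung_of_cor_16_2`).  Vacuous unless `ω(N) ≫ ε log N / log log N` (near-primorial
conductors): a COUNT-form shadow of Szpiro in the many-prime regime; no tool in the cone. -/
theorem stub_midCensus :
    ∀ ε : ℝ, 0 < ε → ∃ C : ℝ, ∀ (W : WeierstrassCurve ℚ) [W.IsElliptic],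
      (∀ p : ℕ, p.Prime → p ≠ 2 → ¬ p ^ 2 ∣ W.conductorNorm ℤ) →
      4 ≤ ((W.conductorNorm ℤ).primeFactors.filter
        (fun p => p ≠ 2 ∧ ¬ p ^ 2 ∣ W.conductorNorm ℤ)).card →
      ((((W.conductorNorm ℤ).primeFactors.filter (fun p => ¬ p ^ 2 ∣ W.conductorNorm ℤ)).filter
          (fun p => ε * Real.log (Real.log (W.conductorNorm ℤ)) <
            Real.log ((W.minimalDiscriminantNorm ℤ).factorization p))).card : ℝ) *
        Real.log (Real.log (W.conductorNorm ℤ)) ≤ ε * Real.log (W.conductorNorm ℤ) + C := by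
  sorry

/-- **stub 3 — giant-exponent MASS (rev 2; replaces `stub_giantCount ∧ stub_singlePrime`).**
For every `ε > 0` there is `C` such that on the class the multiplicative primes with `ord_p Δ_min > log N`
satisfy `Σ log (ord_p Δ_min) ≤ ε log N + C`.  Implied by the crux (a sub-sum of the non-negative terms of
`log T`; certificate `giantMass_of_manyPrime`), hence necessary; implies the one-prime bound
`ord_p Δ_min ≤ e^C N^ε ∨ ord_p Δ_min ≤ log N` (old `stub_singlePrime`, Disproof §6).  In print: Pasten
Cor 16.2 gives `Σ ≤ (11/2+ε) log N + C`.  For Frey curves of `1 + (2ⁿ−1) = 2ⁿ`: "the primes of huge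
exponent in `abc` carry sub-exponential entropy", i.e. `Σ_{v_p(abc) > log rad} log v_p(abc) = o(log rad)`.
Technique warning: linear forms in logarithms give `v_p ≪ N^{1/3+ε}` at best
(`Literature.Barriers.ABC.BakerMethodBounds`). -/
theorem stub_giantMass :
    ∀ ε : ℝ, 0 < ε → ∃ C : ℝ, ∀ (W : WeierstrassCurve ℚ) [W.IsElliptic],
      (∀ p : ℕ, p.Prime → p ≠ 2 → ¬ p ^ 2 ∣ W.conductorNorm ℤ) →
      4 ≤ ((W.conductorNorm ℤ).primeFactors.filter
        (fun p => p ≠ 2 ∧ ¬ p ^ 2 ∣ W.conductorNorm ℤ)).card →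
      ∑ p ∈ ((W.conductorNorm ℤ).primeFactors.filter (fun p => ¬ p ^ 2 ∣ W.conductorNorm ℤ)).filter
          (fun p => Real.log (W.conductorNorm ℤ) <
            (((W.minimalDiscriminantNorm ℤ).factorization p : ℕ) : ℝ)),
        Real.log ((W.minimalDiscriminantNorm ℤ).factorization p) ≤
          ε * Real.log (W.conductorNorm ℤ) + C := by
  sorry

/-! ## The reduction (sorry-free) -/

/-- A conductor with `≥ 4` odd prime factors of the filtered kind is `≥ 3`. -/
theorem three_le_of_card {N : ℕ}
    (h4 : 4 ≤ (N.primeFactors.filter (fun p => p ≠ 2 ∧ ¬ p ^ 2 ∣ N)).card) : 3 ≤ N := by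
  obtain ⟨p, hp⟩ : (N.primeFactors.filter (fun p => p ≠ 2 ∧ ¬ p ^ 2 ∣ N)).Nonempty := by
    rw [← Finset.card_pos]; omega
  rw [Finset.mem_filter, Nat.mem_primeFactors] at hp
  obtain ⟨⟨hpp, hpN, hN0⟩, hp2, -⟩ := hp
  have h2 := hpp.two_le
  have h3 : 3 ≤ p := by omega
  exact h3.trans (Nat.le_of_dvd (Nat.pos_of_ne_zero hN0) hpN)

/-- **Three-regime bookkeeping** (abstract form, rev 2): split `∑_{p ∈ S} log v_p` into
tiny (`log v_p ≤ ε' LL`) / mid (`ε' LL < log v_p`, `v_p ≤ L`) / giant (`v_p > L`). -/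
theorem core_bound (S : Finset ℕ) (v : ℕ → ℕ) (ω : ℕ) (L LL ε' C₀ C₁ C₂ : ℝ)
    (hS : S.card ≤ ω) (hv : ∀ p ∈ S, 1 ≤ v p)
    (hLL : 0 ≤ LL) (hLLdef : Real.log L = LL) (hε' : 0 ≤ ε')
    (hω : (ω : ℝ) * LL ≤ C₀ * L)
    (hmid : ((S.filter (fun p => ε' * LL < Real.log (v p))).card : ℝ) * LL ≤ ε' * L + C₁)
    (hgiant : ∑ p ∈ S.filter (fun p => L < (v p : ℝ)), Real.log (v p) ≤ ε' * L + C₂) :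
    ∑ p ∈ S, Real.log (v p) ≤ ε' * (C₀ + 2) * L + (C₁ + C₂) := by
  have hvpos : ∀ p ∈ S, (0 : ℝ) < v p := fun p hp => by exact_mod_cast hv p hp
  -- tiny regime
  have h1 : ∑ p ∈ S.filter (fun p => ¬ (ε' * LL < Real.log (v p))), Real.log (v p)
      ≤ ε' * C₀ * L := by
    have hle := Finset.sum_le_card_nsmul (S.filter (fun p => ¬ (ε' * LL < Real.log (v p))))
      (fun p => Real.log (v p)) (ε' * LL)
      (fun p hp => not_lt.mp (Finset.mem_filter.mp hp).2)
    rw [nsmul_eq_mul] at hle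
    have hcard : ((S.filter (fun p => ¬ (ε' * LL < Real.log (v p)))).card : ℝ) ≤ ω := by
      exact_mod_cast (Finset.card_filter_le _ _).trans hS
    calc ∑ p ∈ S.filter (fun p => ¬ (ε' * LL < Real.log (v p))), Real.log (v p)
        ≤ ((S.filter (fun p => ¬ (ε' * LL < Real.log (v p)))).card : ℝ) * (ε' * LL) := hle
      _ ≤ ω * (ε' * LL) := by apply mul_le_mul_of_nonneg_right hcard; positivity
      _ = ε' * (ω * LL) := by ring
      _ ≤ ε' * (C₀ * L) := mul_le_mul_of_nonneg_left hω hε'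
      _ = ε' * C₀ * L := by ring
  -- mid regime
  have h2 : ∑ p ∈ (S.filter (fun p => ε' * LL < Real.log (v p))).filter
        (fun p => (v p : ℝ) ≤ L), Real.log (v p) ≤ ε' * L + C₁ := by
    have hle := Finset.sum_le_card_nsmul
      ((S.filter (fun p => ε' * LL < Real.log (v p))).filter (fun p => (v p : ℝ) ≤ L))
      (fun p => Real.log (v p)) LL
      (fun p hp => by
        have hp' := Finset.mem_filter.mp hp
        have hpS := (Finset.mem_filter.mp hp'.1).1
        calc Real.log (v p) ≤ Real.log L := Real.log_le_log (hvpos p hpS) hp'.2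
          _ = LL := hLLdef)
    rw [nsmul_eq_mul] at hle
    have hcard : (((S.filter (fun p => ε' * LL < Real.log (v p))).filter
        (fun p => (v p : ℝ) ≤ L)).card : ℝ)
        ≤ (S.filter (fun p => ε' * LL < Real.log (v p))).card := by
      exact_mod_cast Finset.card_filter_le _ _
    calc ∑ p ∈ (S.filter (fun p => ε' * LL < Real.log (v p))).filter
          (fun p => (v p : ℝ) ≤ L), Real.log (v p)
        ≤ (((S.filter (fun p => ε' * LL < Real.log (v p))).filter
            (fun p => (v p : ℝ) ≤ L)).card : ℝ) * LL := hle
      _ ≤ ((S.filter (fun p => ε' * LL < Real.log (v p))).card : ℝ) * LL :=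
          mul_le_mul_of_nonneg_right hcard hLL
      _ ≤ ε' * L + C₁ := hmid
  -- giant regime: a sub-sum of the giant mass (all terms are `≥ 0`)
  have h3 : ∑ p ∈ (S.filter (fun p => ε' * LL < Real.log (v p))).filter
        (fun p => ¬ ((v p : ℝ) ≤ L)), Real.log (v p) ≤ ε' * L + C₂ := by
    have hsub : (S.filter (fun p => ε' * LL < Real.log (v p))).filter
        (fun p => ¬ ((v p : ℝ) ≤ L)) ⊆ S.filter (fun p => L < (v p : ℝ)) := by
      intro p hp
      have hp' := Finset.mem_filter.mp hp
      have hpS := (Finset.mem_filter.mp hp'.1).1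
      exact Finset.mem_filter.mpr ⟨hpS, not_le.mp hp'.2⟩
    exact (Finset.sum_le_sum_of_subset_of_nonneg hsub
      (fun p _ _ => Real.log_natCast_nonneg (v p))).trans hgiant
  -- reassemble
  rw [← Finset.sum_filter_add_sum_filter_not S (fun p => ε' * LL < Real.log (v p)),
    ← Finset.sum_filter_add_sum_filter_not (S.filter (fun p => ε' * LL < Real.log (v p)))
      (fun p => (v p : ℝ) ≤ L)]
  have hring : ε' * C₀ * L + (ε' * L + C₁) + (ε' * L + C₂) = ε' * (C₀ + 2) * L + (C₁ + C₂) := by ring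
  linarith [h1, h2, h3]

/-- **Three-regime bookkeeping** (arithmetic form over a conductor `N` and a discriminant `Δ`, rev 2). -/
theorem assemble (N Δ : ℕ) (ε ε' C₀ C₁ C₂ : ℝ)
    (hN : 3 ≤ N) (hε'K : ε' * (C₀ + 2) = ε) (hε'pos : 0 < ε')
    (hω : (N.primeFactors.card : ℝ) * Real.log (Real.log N) ≤ C₀ * Real.log N)
    (hmid : (((N.primeFactors.filter (fun p => ¬ p ^ 2 ∣ N)).filter
        (fun p => ε' * Real.log (Real.log N) < Real.log (Δ.factorization p))).card : ℝ)
        * Real.log (Real.log N) ≤ ε' * Real.log N + C₁)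
    (hgiant : ∑ p ∈ (N.primeFactors.filter (fun p => ¬ p ^ 2 ∣ N)).filter
        (fun p => Real.log N < ((Δ.factorization p : ℕ) : ℝ)), Real.log (Δ.factorization p)
        ≤ ε' * Real.log N + C₂) :
    ((∏ p ∈ N.primeFactors with ¬ p ^ 2 ∣ N, Δ.factorization p : ℕ) : ℝ)
      ≤ Real.exp (C₁ + C₂) * (N : ℝ) ^ ε := by
  have hN0 : (0 : ℝ) < N := by exact_mod_cast (by omega : 0 < N)
  have hL1 : 1 ≤ Real.log N := by
    have h3 : (3 : ℝ) ≤ N := by exact_mod_cast hN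
    have he : Real.exp 1 ≤ (N : ℝ) := by
      have := Real.exp_one_lt_d9
      linarith
    have := Real.log_le_log (Real.exp_pos 1) he
    rwa [Real.log_exp] at this
  have hL0 : 0 ≤ Real.log N := by linarith
  have hLL0 : 0 ≤ Real.log (Real.log N) := Real.log_nonneg hL1
  rw [Nat.cast_prod]
  by_cases hzero : ∃ p ∈ N.primeFactors.filter (fun p => ¬ p ^ 2 ∣ N), Δ.factorization p = 0
  · obtain ⟨p, hp, hp0⟩ := hzero
    rw [Finset.prod_eq_zero hp (by simp [hp0])]
    positivity
  push Not at hzero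
  have hv1 : ∀ p ∈ N.primeFactors.filter (fun p => ¬ p ^ 2 ∣ N), 1 ≤ Δ.factorization p :=
    fun p hp => Nat.one_le_iff_ne_zero.mpr (hzero p hp)
  have hpos : ∀ p ∈ N.primeFactors.filter (fun p => ¬ p ^ 2 ∣ N),
      (0 : ℝ) < ((Δ.factorization p : ℕ) : ℝ) := fun p hp => by exact_mod_cast hv1 p hp
  have hP : 0 < ∏ p ∈ N.primeFactors.filter (fun p => ¬ p ^ 2 ∣ N), ((Δ.factorization p : ℕ) : ℝ) :=
    Finset.prod_pos hpos
  have key := core_bound (N.primeFactors.filter (fun p => ¬ p ^ 2 ∣ N)) (fun p => Δ.factorization p)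
    N.primeFactors.card (Real.log N) (Real.log (Real.log N)) ε' C₀ C₁ C₂
    (Finset.card_filter_le _ _) hv1 hLL0 rfl hε'pos.le hω hmid hgiant
  have hsum : Real.log (∏ p ∈ N.primeFactors.filter (fun p => ¬ p ^ 2 ∣ N), ((Δ.factorization p : ℕ) : ℝ))
      = ∑ p ∈ N.primeFactors.filter (fun p => ¬ p ^ 2 ∣ N), Real.log ((Δ.factorization p : ℕ) : ℝ) :=
    Real.log_prod (fun p hp => (hpos p hp).ne')
  have hεL : ε' * (C₀ + 2) * Real.log N ≤ ε * Real.log N := by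
    rw [hε'K]
  calc ∏ p ∈ N.primeFactors.filter (fun p => ¬ p ^ 2 ∣ N), ((Δ.factorization p : ℕ) : ℝ)
      = Real.exp (Real.log (∏ p ∈ N.primeFactors.filter (fun p => ¬ p ^ 2 ∣ N),
          ((Δ.factorization p : ℕ) : ℝ))) := (Real.exp_log hP).symm
    _ ≤ Real.exp (ε * Real.log N + (C₁ + C₂)) := by
        rw [Real.exp_le_exp, hsum]
        linarith [key, hεL]
    _ = Real.exp (C₁ + C₂) * (N : ℝ) ^ ε := by
        rw [Real.exp_add, Real.rpow_def_of_pos hN0, mul_comm (Real.log N) ε]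
        ring

/-- **The decomposition, closed form (no sorry):** the three regime statements imply the crux, stated here
with the crux unfolded (so that only `ManyPrimeValuationProduct_of` concludes the route decl by name). -/
theorem of_parts
    (hω : ∃ C₀ : ℝ, ∀ n : ℕ, (n.primeFactors.card : ℝ) * Real.log (Real.log n) ≤ C₀ * Real.log n)
    (hmid : ∀ ε : ℝ, 0 < ε → ∃ C : ℝ, ∀ (W : WeierstrassCurve ℚ) [W.IsElliptic],
      (∀ p : ℕ, p.Prime → p ≠ 2 → ¬ p ^ 2 ∣ W.conductorNorm ℤ) →
      4 ≤ ((W.conductorNorm ℤ).primeFactors.filter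
        (fun p => p ≠ 2 ∧ ¬ p ^ 2 ∣ W.conductorNorm ℤ)).card →
      ((((W.conductorNorm ℤ).primeFactors.filter (fun p => ¬ p ^ 2 ∣ W.conductorNorm ℤ)).filter
          (fun p => ε * Real.log (Real.log (W.conductorNorm ℤ)) <
            Real.log ((W.minimalDiscriminantNorm ℤ).factorization p))).card : ℝ) *
        Real.log (Real.log (W.conductorNorm ℤ)) ≤ ε * Real.log (W.conductorNorm ℤ) + C)
    (hgiant : ∀ ε : ℝ, 0 < ε → ∃ C : ℝ, ∀ (W : WeierstrassCurve ℚ) [W.IsElliptic],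
      (∀ p : ℕ, p.Prime → p ≠ 2 → ¬ p ^ 2 ∣ W.conductorNorm ℤ) →
      4 ≤ ((W.conductorNorm ℤ).primeFactors.filter
        (fun p => p ≠ 2 ∧ ¬ p ^ 2 ∣ W.conductorNorm ℤ)).card →
      ∑ p ∈ ((W.conductorNorm ℤ).primeFactors.filter (fun p => ¬ p ^ 2 ∣ W.conductorNorm ℤ)).filter
          (fun p => Real.log (W.conductorNorm ℤ) <
            (((W.minimalDiscriminantNorm ℤ).factorization p : ℕ) : ℝ)),
        Real.log ((W.minimalDiscriminantNorm ℤ).factorization p) ≤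
          ε * Real.log (W.conductorNorm ℤ) + C) :
    ∀ ε : ℝ, 0 < ε → ∃ C : ℝ, ∀ (W : WeierstrassCurve ℚ) [W.IsElliptic],
      (∀ p : ℕ, p.Prime → p ≠ 2 → ¬ p ^ 2 ∣ W.conductorNorm ℤ) →
      4 ≤ ((W.conductorNorm ℤ).primeFactors.filter
        (fun p => p ≠ 2 ∧ ¬ p ^ 2 ∣ W.conductorNorm ℤ)).card →
      ((∏ p ∈ (W.conductorNorm ℤ).primeFactors with ¬ p ^ 2 ∣ W.conductorNorm ℤ,
        (W.minimalDiscriminantNorm ℤ).factorization p : ℕ) : ℝ) ≤ C * (W.conductorNorm ℤ : ℝ) ^ ε := by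
  intro ε hε
  obtain ⟨C₀, hC₀⟩ := hω
  have hKpos : (0 : ℝ) < max C₀ 0 + 2 := by positivity
  have hε'pos : 0 < ε / (max C₀ 0 + 2) := div_pos hε hKpos
  obtain ⟨C₁, hC₁⟩ := hmid _ hε'pos
  obtain ⟨C₂, hC₂⟩ := hgiant _ hε'pos
  refine ⟨Real.exp (C₁ + C₂), ?_⟩
  intro W _ hss h4
  exact assemble (W.conductorNorm ℤ) (W.minimalDiscriminantNorm ℤ) ε
    (ε / (max C₀ 0 + 2)) (max C₀ 0) C₁ C₂
    (three_le_of_card h4) (div_mul_cancel₀ ε hKpos.ne') hε'pos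
    ((hC₀ _).trans (mul_le_mul_of_nonneg_right (le_max_left _ _) (Real.log_natCast_nonneg _)))
    (hC₁ W hss h4) (hC₂ W hss h4)

/-- **Skeleton theorem**: the crux BY NAME from the three registered stubs (one landed, two open). -/
theorem ManyPrimeValuationProduct_of :
    Summit.ABC.ABC.Theses.RibetTakahashiSplit.ManyPrimeValuationProduct :=
  of_parts stub_omegaLogLog stub_midCensus stub_giantMass

end Summit.ABC.ABC.Cruxes.ManyPrimeValuationProduct.UnramifiedWindowCensus
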